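import Summits.QuantumFields.YangMills.Theorems.FluctuationComparisonRegPrIntLRunpairOrganDischargeInputsHJsqV04EDefs
import Summits.QuantumFields.YangMills.Theorems.FluctuationComparisonRegPrIntLELetterExtraction
import Summits.QuantumFields.YangMills.Theorems.FluctuationComparisonRegPrIntLOrganTangentJTSqOfHdispCrude
import Summits.QuantumFields.YangMills.Theorems.FluctuationComparisonRegPrIntLRunpairOrganFibreLawJSqEDefs
import Summits.QuantumFields.YangMills.Theorems.FluctuationComparisonRegPrIntLOrganTangentJV0OfCornerStability
import Summits.QuantumFields.YangMills.Theorems.FluctuationComparisonRegPrIntLOrganTangentCovSandwichSq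
import Summits.QuantumFields.YangMills.Theorems.FluctuationComparisonRegPrIntLOrganTangentJTSqOfHdispNear
import Summits.QuantumFields.YangMills.Theorems.FluctuationComparisonRegPrIntLOrganTangentLawClausesOfILawSplit
import Summits.QuantumFields.YangMills.Theorems.FluctuationComparisonRegPrIntLOrganTangentLawClausesOfILawAE
import Summits.QuantumFields.YangMills.Theorems.FluctuationComparisonRegPrIntLOrganTangentLawClausesOfILaw
import Summits.QuantumFields.YangMills.Theorems.FluctuationComparisonRegPrIntLOrganTangentLawJClausesOfILaw
import Summits.QuantumFields.YangMills.Theorems.FluctuationComparisonRegPrIntLOrganTangentLawClausesOfILawSq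
import Summits.QuantumFields.YangMills.Theorems.FluctuationComparisonRegPrIntLOrganTangentILawKnitFactsSq
import Summits.QuantumFields.YangMills.Theorems.FluctuationComparisonRegPrIntLOrganTangentFibreWeightNormalisation
import Summits.QuantumFields.YangMills.Theorems.FluctuationComparisonRegPrIntLOrganTangentILawKnitFacts
import Summits.QuantumFields.YangMills.Theorems.FluctuationComparisonRegPrIntLOrganTangentMultiWindowWeight
import Summits.QuantumFields.YangMills.Theorems.FluctuationComparisonRegPrIntLOrganTangentFibreMeanVersionMW
import Summits.QuantumFields.YangMills.Theorems.FluctuationComparisonRegPrIntLOrganTangentAPackageDescendTo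
import Summits.QuantumFields.YangMills.Theorems.FluctuationComparisonRegPrIntLRunpairOrganFibreLawDefs
import Literature.MathematicalPhysics.QuantumFieldTheory.Balaban1983to89.BalabanAdmissibleClassParams
import Literature.MathematicalPhysics.QuantumFieldTheory.Balaban1983to89.T4AveragingDisintegration
import Literature.MathematicalPhysics.QuantumFieldTheory.Balaban1983to89.T4CubeChartExp
import HarnessLib

/-!
# Route `UnitScaleTilt` — crux `FluctuationComparisonRegPrIntL` (stmt-QuantumFields-20520, rung R3), PATH-B organ, sq-programme: «THE ORGAN DISCHARGE KNIT, NEAR-PAIR ("sq") EDITION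
# v0.4ᴱ (v19 «BACKGROUND WINDOWS» RE-LETTERING), THEOREMS-SIDE» — `spreadFibreLawHJsq_of_dischargeInputsSq : OrganDischargeInputsHJsq`(v0.4ᴱ) `→ SpreadFibreLawHJsq`(ᴱ)

Cell `ym3-torus` (YM ladder rung R3 = continuum `SU(2)` Yang–Mills on the three-torus — a RUNG: NOT d = 4, NOT infinite volume, NOT a mass gap, NOT Clay).
Width seat `ym-ust-20520-w4` (gen 26), E7 of the sq-CHAIN-ᴱ (LEAD `ym-ust-20520-w3` g28 RULING №60 (E) «BACKGROUND WINDOWS» ∕ RULING №61 ∕ №44–№47; w4 g26 №23 map E1–E8):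
the TREE knit-V04 ✓`…OrganTangentSpreadFibreLawHJsqOfDischargeInputsSqV04` (p823865; LEAD w3 g27's proof) CUT BY SCRIPT (`cut_knit_E.py`, HOME `ym-ust-20520-w4/g26/echain/`) onto
the ᴱ editions of its two ends: hypothesis = ✓`…RunpairOrganDischargeInputsHJsqV04EDefs.OrganDischargeInputsHJsq` (E6, row-sq v0.4ᴱ = `Cruxes/…/DischargeInputsHJsq.lean` after
LEAD №48's write 18:38Z of ideator g31's PRE e5b64ff5ff716873, commit b31260f07b3d), conclusion = ✓`…RunpairOrganFibreLawJSqE.SpreadFibreLawHJsq` (E1) — BOTH written FULLY QUALIFIED in the signature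
(LEAD RULING №99: the statement's source text names its editions; `dedup.landed` keys on text).  v0.4ᴱ∕ᴱ differ from v0.4∕p819394 ONLY in the frame's two «block ⑤»
class-membership tokens (old `∃ κ, MemAtHeight F ℰp j (prm j) (e^κ·ρ j)` ↦ px8 g25's (E)-letter `Φ_h[ρ j]`, same on both ends), which the knit passes through (`hwin`) and
CONSUMES at exactly one place — measurability of `ρ Ts`, `ρ' Ts` for the (I-law) a.e. doors: p823865's 8-line local helper `hmeasT` (`hκ'.measurable` + un-scaling) and its two
uses are replaced by two lines `measurable_of_phiH F Ts prm (ρ Ts) (hwin Ts …).2.2.2.1` ∕ `… (ρ' Ts) ….2.2.2.2.1` over px8 g25's ✓`…FluctuationComparisonRegPrIntLELetterExtraction`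
(p830750, SPEC-2 extraction; imported, not copied — LEAD №47 (B)).  EVERYTHING ELSE of the proof block is p823865 BYTE-KEPT (diff = imports 2 lines → 3, header, namespace
`…SqV04 → …SqV04E`, two `open` lines re-pointed + one added, theorem docstring, signature 2 lines, the `hmeasT` hunk; no other hunk): (JT-h)sq by px19 g22's A5 door
✓p823618 `jtBracket_sq_of_hdisp_crude`, (L1ʲ-h)sq ∕ (L2ʲ-h) ∕ (JV3-h′)sq ∕ (JV4-h′) by ✓p821651's AE doors with ✓p819333's path facts, (JV0-h)sq ✓p819361, (JV1-h)sq ∕ (JV2-h)sq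
✓p819216, `exists_height_multiWindowWeight`, `wNum_nonneg` — the eleven door modules carry no block-⑤ token (w4 g26 №23: 0 grep hits each), so they are imported unchanged.
`--kind proof --supports stmt-QuantumFields-20520 --as helper`, count-neutral, DEFINITION-FREE, no registry ∕ binder ∕ `Lines/` edit, default heartbeats, `autoImplicit false`.

WHAT THIS IS.  «ROW-sq v0.4ᴱ ⟹ HJsqᴱ»: with w5 g26's sq-apexᴱ `…OrganTangentOneStepTransportUHOfSpreadFibreLawHJsqE` (E5: HJsqᴱ ⟹ O1ᵘ-H′ = the v19.0 line text
`OneStepTransportUH`) it gives the apex-V04ᴱ `…OrganTangentOneStepTransportUHOfDischargeInputsHJsqV04E` (E8, next file): O1ᵘ-H′ ⟸ `OrganDischargeInputsHJsq`(v0.4ᴱ) — the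
ᴱ re-lettering of ✓p824031's edge, so that line v19.0's row edge can be restored on ONE letter (RULING №61 (D)).

HONEST FRAMING: a junction over HYPOTHESIS texts — it proves «ROW-sq v0.4ᴱ ⟹ HJsqᴱ» and discharges NOTHING of the row; `OrganDischargeInputsHJsq` (v0.4ᴱ) is EXACTLY AS OPEN
as `SpreadFibreLawHJsq`(ᴱ), as v0.4 and as v0.3 (its letters `c Db DP` ∕ `hdisp`, the crude curvature letters `kG kB ES Good`, the (Lip) weight-path facts and the a.e. score
kernels, `Prof` ∕ (G)(K•), and the background-window letters `bg supp foot len wt act cst lf` of Φ_h are what a discharger must PROVE from [Balaban1985Variational] Thm 1 ∕ Prop 9,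
[Balaban1985Averaging] (9)–(13), [Balaban1987RG1] Thm 1 ∕ Thm 3 — SOURCES only); nothing of Bałaban's analysis is asserted or proved; `SpreadFibreLawH(J)(sq)`(ᴱ) ∕
`OrganDischargeInputsHJ(sq)` (every edition) UNDISCHARGED; S1aᴴ, S3ᴴ, O1ᵘ-H(′) (as facts), the five registered stubs of `Lines/runpair_organ.lean` (registry 3732b7df, untouched),
crux 20520 and `YM3TorusSU2` are NOT proved; rung R3 = SU(2) YM₃ on T³ at fixed lattice data — NOT d = 4, NOT infinite volume, NOT a mass gap, NOT Clay; the Yang–Mills mass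
gap is NOT proved.  Credit: LEAD w3 g26∕g27∕g28 (the proof, DISCHARGE-SPEC, rulings), ideator g29∕g31 (rows, v19 texts), px8 g25 (the (E) letter and its extraction file),
px19 g22 (the A5 door), w5 g24–g26 (the (I-law) lane, sq-chain-ᴱ second hand), px19 g20∕g21, px20 g21, px5 g21 (the sq doors), desk g44–g47.
-/

set_option autoImplicit false

noncomputable section

namespace Summit.QuantumFields.YangMills.Theorems.OrganTangentSpreadFibreLawHJsqOfDischargeInputsSqV04E

open MeasureTheory Filter Topology Function
open scoped ENNReal NNReal BigOperators
open Literature.MathematicalPhysics.QuantumFieldTheory.Balaban1983to89 T3ContinuumYM3Torus T3NestedUnitLaws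
  T3UnitLawDensityEML T4Continuum BalabanUVClass T3UnitScaleTilt T3LevelShift T3TiltDescent
open T4CubeChartExp (expPt)
open Summit.QuantumFields.YangMills.Theorems.FluctuationComparisonRegPrIntLRunpairOrganFibreLaw (mwCut wNum wgt)
open Summit.QuantumFields.YangMills.Theorems.FluctuationComparisonRegPrIntLRunpairOrganFibreLawJSqE (SpreadFibreLawHJsq)
open Summit.QuantumFields.YangMills.Theorems.FluctuationComparisonRegPrIntLRunpairOrganDischargeInputsHJsqV04E (OrganDischargeInputsHJsq)
open Summit.QuantumFields.YangMills.Theorems.FluctuationComparisonRegPrIntLELetterExtraction (measurable_of_phiH)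
open Summit.QuantumFields.YangMills.Theorems.FluctuationComparisonRegPrIntLOrganTangentMultiWindowWeight (exists_height_multiWindowWeight)
open Summit.QuantumFields.YangMills.Theorems.OrganTangentJV0OfCornerStability (jv0ClauseSq_of_hdisp)
open Summit.QuantumFields.YangMills.Theorems.OrganTangentCovSandwichSq (jv1ClauseSq_of_covKernel_profiles jv2ClauseSq_of_covKernel_profiles)
open Summit.QuantumFields.YangMills.Theorems.OrganTangentJTSqOfHdispCrude (jtBracket_sq_of_hdisp_crude)
open Summit.QuantumFields.YangMills.Theorems.OrganTangentLawClausesOfILawAE (l1jSq_of_ilawAE l2j_of_ilawAE jv3Sq_of_ilawAE jv4_of_ilawAE)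
open Summit.QuantumFields.YangMills.Theorems.OrganTangentFibreWeightNormalisation (wNum_nonneg)
open Summit.QuantumFields.YangMills.Theorems.OrganTangentILawKnitFacts (hrc_of_sqrt3_mul_le)
open Summit.QuantumFields.YangMills.Theorems.OrganTangentILawKnitFactsSq (hpath_l1jSq_of_hdisp hpath_jv3Sq_of_hdisp hsqpath_l2j_of_hdisp hsqpath_jv4_of_hdisp)
open Set (Icc)

/-- ★★★ **THE ORGAN DISCHARGE KNIT, sq EDITION v0.4ᴱ** (v19 «background windows» re-lettering): `OrganDischargeInputsHJsq`(v0.4ᴱ) `→ SpreadFibreLawHJsq`(ᴱ) — p823865's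
proof byte-kept (prefix and chart [0]–[11] pass through; (JT-h)sq by ✓p823618 `jtBracket_sq_of_hdisp_crude`, (L1ʲ-h)sq∕(L2ʲ-h)∕(JV3-h′)sq∕(JV4-h′) by ✓p821651
`l1jSq∕l2j∕jv3Sq∕jv4_of_ilawAE` + ✓p819333 path facts, (JV0-h)sq by ✓p819361, (JV1-h)sq∕(JV2-h)sq by ✓p819216) except that measurability of `ρ Ts`, `ρ' Ts` is read off
the frame's Φ_h letter by ✓p830750 `measurable_of_phiH` (module docstring).  A junction over hypothesis texts: it discharges nothing of the row. [folklore] -/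
theorem spreadFibreLawHJsq_of_dischargeInputsSq (hD : Summit.QuantumFields.YangMills.Theorems.FluctuationComparisonRegPrIntLRunpairOrganDischargeInputsHJsqV04E.OrganDischargeInputsHJsq) :
    Summit.QuantumFields.YangMills.Theorems.FluctuationComparisonRegPrIntLRunpairOrganFibreLawJSqE.SpreadFibreLawHJsq := by
  classical
  unfold SpreadFibreLawHJsq
  obtain ⟨pW, γ₁, hγ₁, hD⟩ := hD
  refine ⟨pW, min γ₁ 1, lt_min hγ₁ one_pos, ?_⟩
  intro F γ hγ hγ1 b₀ p₀ j₀ prm η rA Bρ hb₀ hp₀ hpW hadm hη0 hηs hηss hηt hrA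
  have hγone : γ ≤ 1 := hγ1.trans (min_le_right _ _)
  obtain ⟨κ₀, hκ₀, hD⟩ := hD F γ hγ (hγ1.trans (min_le_left _ _)) b₀ p₀ j₀ prm η rA Bρ hb₀ hp₀ hpW hadm hη0 hηs hηss hηt hrA
  refine ⟨κ₀, hκ₀, ?_⟩
  intro κ hκ hκle
  obtain ⟨rc, w₀, NT, NX, NL, CJ, NV1, NV2, NV3, NV4, δT, δX, δL, δV1, δV2, δV3, δV4, j₁, hrc, hw₀, hNT, hNX, hNL, hCJ,
    hδ0, hδTs, hδTss, hδTt, hδXs, hδXss, hδXt, hδLs, hδLss, hδLt, hVfacts, hj₁, hD⟩ := hD κ hκ hκle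
  obtain ⟨jA, hMWA⟩ := exists_height_multiWindowWeight F γ b₀ p₀ hγ hγone hb₀
  refine ⟨rc, w₀, NT, NX, NL, CJ, NV1, NV2, NV3, NV4, δT, δX, δL, δV1, δV2, δV3, δV4, max j₁ jA, hrc, hw₀, hNT, hNX, hNL, hCJ,
    hδ0, hδTs, hδTss, hδTt, hδXs, hδXss, hδXt, hδLs, hδLss, hδLt, hVfacts, hj₁.trans (le_max_left _ _), ?_⟩
  intro ν hG hCν K K' hKK' Ts T hTs hTK μ μ' ρ ρ' hanch hcut hcons hfin hwin j hj hjTs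
  have hj1 : j₁ ≤ j := (le_max_left _ _).trans hj
  have hjA : jA ≤ j := (le_max_right _ _).trans hj
  obtain ⟨Z, instZ, τ, Φ, J, S, π, hτ, hΦm, hJm, hSm, hS, hsec, hdis, hcont, hJle, hpos, hπ1, hπ2, hgeo, hseedgrp⟩ :=
    hD ν hG hCν K K' hKK' Ts T hTs hTK μ μ' ρ ρ' hanch hcut hcons hfin hwin j hj1 hjTs
  obtain ⟨c, Db, DP, hrc16, hc, hDb0, hDPle, hdisp, hroom3⟩ := hgeo
  -- frame facts
  have hθj : 0 < θBal F.L γ b₀ p₀ j := T3MinimiserStabilityReduction.θBal_pos F.hL.2.le hγ hγone hb₀ p₀ j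
  have hθT : 0 < θBal F.L γ b₀ p₀ Ts := T3MinimiserStabilityReduction.θBal_pos F.hL.2.le hγ hγone hb₀ p₀ Ts
  have hθ4 : 0 < θBal F.L γ b₀ p₀ j / 4 := by positivity
  have hTs₀ : j₀ ≤ Ts := by omega
  have hTsT : Ts ≤ T := hTs.le
  have hposT : ∀ U, PlaqSmall (θBal F.L γ b₀ p₀ Ts) U → 0 < ρ Ts U ∧ 0 < ρ' Ts U := fun U hU => (hwin Ts hTs₀ hTsT).1 U hU
  have hcT : ContinuousOn (ρ Ts) {U | PlaqSmall (θBal F.L γ b₀ p₀ Ts) U} := (hwin Ts hTs₀ hTsT).2.2.2.2.2.2.2.1.1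
  have hcT' : ContinuousOn (ρ' Ts) {U | PlaqSmall (θBal F.L γ b₀ p₀ Ts) U} := (hwin Ts hTs₀ hTsT).2.2.2.2.2.2.2.1.2
  -- ᴱ edition: block ⑤ is px8 g25's Φ_h letter; measurability of `ρ Ts`, `ρ' Ts` by ✓p830750's extraction lemma (SPEC-2)
  have hρm : Measurable (ρ Ts) := measurable_of_phiH F Ts prm (ρ Ts) (hwin Ts hTs₀ hTsT).2.2.2.1
  have hρ'm : Measurable (ρ' Ts) := measurable_of_phiH F Ts prm (ρ' Ts) (hwin Ts hTs₀ hTsT).2.2.2.2.1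
  obtain ⟨hχc, hχ0, hχsupp, hχpos⟩ := hMWA j hjA Ts hjTs
  haveI := hτ
  -- knit-side facts for the (I-law) dock
  have hw0 : ∀ (t : ℝ) (V : GaugeField (F.P j) 0 ↥(Matrix.specialUnitaryGroup (Fin 2) ℂ)) (z : Z), 0 ≤ wNum F γ b₀ p₀ j Ts ρ ρ' Φ J t V z :=
    wNum_nonneg F γ b₀ p₀ j Ts hjTs ρ ρ' hposT hθT hχ0 hχsupp Φ J
  have hΦV : ∀ V : GaugeField (F.P j) 0 ↥(Matrix.specialUnitaryGroup (Fin 2) ℂ), Measurable fun z : Z => Φ (V, z) := fun V => hΦm.comp (measurable_const.prodMk measurable_id)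
  have hmF : ∀ V : GaugeField (F.P j) 0 ↥(Matrix.specialUnitaryGroup (Fin 2) ℂ), AEStronglyMeasurable (fun z => Real.log (ρ Ts (Φ (V, z))) - Real.log (ρ' Ts (Φ (V, z)))) τ :=
    fun V => ((Real.measurable_log.comp (hρm.comp (hΦV V))).sub (Real.measurable_log.comp (hρ'm.comp (hΦV V)))).aestronglyMeasurable
  have hmW : ∀ (t : ℝ) (V : GaugeField (F.P j) 0 ↥(Matrix.specialUnitaryGroup (Fin 2) ℂ)), AEStronglyMeasurable (fun z => wNum F γ b₀ p₀ j Ts ρ ρ' Φ J t V z) τ := by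
    intro t V
    haveI : CompactSpace (GaugeField (F.P Ts) 0 ↥(Matrix.specialUnitaryGroup (Fin 2) ℂ)) :=
      inferInstanceAs (CompactSpace (PBond (F.P Ts) 0 → ↥(Matrix.specialUnitaryGroup (Fin 2) ℂ)))
    haveI : BorelSpace (GaugeField (F.P Ts) 0 ↥(Matrix.specialUnitaryGroup (Fin 2) ℂ)) :=
      Literature.MathematicalPhysics.QuantumFieldTheory.Balaban1983to89.T3OrbitAverage.instBorelSpaceGaugeField
    have hJm1 : Measurable fun z => (J (V, z) : ℝ) := (hJm.comp (measurable_const.prodMk measurable_id)).coe_nnreal_real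
    have h1 : Measurable fun z => mwCut F γ b₀ p₀ j Ts (Φ (V, z)) := hχc.measurable.comp (hΦV V)
    have h2 : Measurable fun z => Real.rpow (ρ Ts (Φ (V, z))) t * Real.rpow (ρ' Ts (Φ (V, z))) (1 - t) :=
      ((hρm.comp (hΦV V)).pow_const t).mul ((hρ'm.comp (hΦV V)).pow_const (1 - t))
    exact ((h1.mul h2).mul hJm1).aestronglyMeasurable
  -- sq PATH-FACTS (✓p819333) from the row's one-bond letter `hdisp` + cap + guard + room₃; (JV0-h)sq by ✓p819361
  have hwin : (1 + 16 * Real.sqrt 3 * rc) * (θBal F.L γ b₀ p₀ j / 4) ≤ θBal F.L γ b₀ p₀ j := hrc_of_sqrt3_mul_le hrc16 hθj.le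
  have hPX := hpath_l1jSq_of_hdisp F γ b₀ p₀ j Ts hjTs ρ ρ' hρm hρ'm hcT hcT' hposT hθT hχc hχ0 hχsupp hχpos τ Φ J hΦm hJm CJ hJle hpos
    c hc hθj Db rc hrc.le hDb0 DP hDPle hwin hdisp hroom3
  have hPV3 := hpath_jv3Sq_of_hdisp F γ b₀ p₀ j Ts hjTs ρ ρ' hρm hρ'm hcT hcT' hposT hθT hχc hχ0 hχsupp hχpos τ Φ J hΦm hJm CJ hJle hpos
    c hc hθj Db rc hrc.le hDb0 DP hDPle hwin hdisp hroom3
  have hSL := hsqpath_l2j_of_hdisp F γ b₀ p₀ j Ts hjTs ρ ρ' hρm hρ'm hcT hcT' hposT hθT hχc hχ0 hχsupp hχpos τ Φ J hΦm hJm CJ hJle hpos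
    c hc hθj Db rc hrc.le hDb0 DP hDPle hwin hdisp hroom3
  have hSV4 := hsqpath_jv4_of_hdisp F γ b₀ p₀ j Ts hjTs ρ ρ' hρm hρ'm hcT hcT' hposT hθT hχc hχ0 hχsupp hχpos τ Φ J hΦm hJm CJ hJle hpos
    c hc hθj Db rc hrc.le hDb0 DP hDPle hwin hdisp hroom3
  have hJV0 := jv0ClauseSq_of_hdisp F γ b₀ p₀ j Ts hjTs ρ ρ' hρm hρ'm hcT hcT' hposT hθT hθj hχc hχ0 hχsupp hχpos τ Φ J hΦm hJm CJ hJle hpos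
    c Db rc hc hrc.le hDb0 DP hDPle hdisp hroom3
  refine ⟨Z, instZ, τ, Φ, J, S, π, hτ, hΦm, hJm, hSm, hS, hsec, hdis, hcont, hJle, hpos, hπ1, hπ2, ?_, ?_⟩
  · -- the (H) block
    intro k w hkw0 hwle hk0 hkrow hksq
    obtain ⟨hcurvT, hlawXL, -, -, -⟩ := hseedgrp k w hkw0 hwle hk0 hkrow hksq
    refine ⟨?_, ?_, ?_⟩
    · -- (JT-h)sq ⟸ (I-geo)sq + (I-curv) by ✓p819624 (law point `Y`)
      intro t ht0 ht1
      obtain ⟨kG, kB, ES, hkG0, hkB0, hES, hmass, hGoodAll⟩ := hcurvT t ht0 ht1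
      refine ⟨fun B B' => kG B B' + ES * kB B B', fun B B' => add_nonneg (hkG0 B B') (mul_nonneg hES (hkB0 B B')), hmass, ?_⟩
      intro B B' m m' U V W Y hm hm' hU hV hW hY hVU hVb hWU hWb hYV hYb
      obtain ⟨Good, hGood, htail, hG, hcrude⟩ := hGoodAll Y hY
      exact jtBracket_sq_of_hdisp_crude F γ b₀ p₀ j Ts hjTs ρ ρ' hρm hρ'm hcT hcT' hposT hθT hθj hχc hχ0 hχsupp hχpos
        τ Φ J hΦm hJm CJ hJle hpos t hc B B' m m' U V W Y Y hm hm' hU hV hW hY hY hVU hVb hWU hWb hYV hYb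
        Db hrc.le hDb0 DP hDPle hdisp hroom3 (Or.inr (Or.inr (Or.inr rfl))) Good hGood (hkG0 B B')
        (hG B B' m m' U V W Y hm hm' hU hV hW hY hVU hVb hWU hWb hYV hYb (Or.inr (Or.inr (Or.inr rfl))))
        (hkB0 B B') hES (hcrude B B' m m' U V W Y hm hm' hU hV hW hY hVU hVb hWU hWb hYV hYb (Or.inr (Or.inr (Or.inr rfl)))) htail
    · -- (L1ʲ-h)sq ⟸ (I-law-X)sq by ✓p819236 `l1jSq_of_ilaw` + ✓p819333
      intro t ht0 ht1
      obtain ⟨hX, -⟩ := hlawXL t ht0 ht1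
      exact l1jSq_of_ilawAE F γ b₀ p₀ j Ts ρ ρ' τ Φ J κ rc w NX δX t (hw0 t) hmF hΦm hJm hρm hρ'm hχc (hPX t) hX
    · -- (L2ʲ-h) ⟸ (I-law-L) by ✓p817463 `l2j_of_ilaw` + ✓p819333
      intro t ht0 ht1
      obtain ⟨-, hL⟩ := hlawXL t ht0 ht1
      exact l2j_of_ilawAE F γ b₀ p₀ j Ts ρ ρ' τ Φ J κ rc w NL δL t (hw0 t) hmF hΦm hJm hρm hρ'm hχc (hSL t) hL
  · -- the (HV′) block
    intro k w hkw0 hwle hk0 hkrow hksq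
    obtain ⟨-, -, hV3, hV4, Prof, 𝒢, ωf, NG, NG₀, K, ωX, Ncol, Nrow, K2, NY, x₀, hG0, hωf, hNG, hGrow, hNG₀, hGrow₀, hCov, hK0, hωX, hNrow, hKcol,
      hKrow, htri, hProf1, hK20, hK2mass, hProf2, hx₀, hProf0, hM2, hM1⟩ := hseedgrp k w hkw0 hwle hk0 hkrow hksq
    refine ⟨hJV0, ?_, ?_, ?_, ?_⟩
    · exact jv1ClauseSq_of_covKernel_profiles τ (fun X z => Real.log (ρ Ts (Φ (X, z))) - Real.log (ρ' Ts (Φ (X, z))))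
        (fun t Xw z => (wgt F γ b₀ p₀ j Ts ρ ρ' τ Φ J t) Xw z) (θBal F.L γ b₀ p₀ j / 4) rc κ (NV1 * ((((F.L : ℝ) ^ j / γ) * θBal F.L γ b₀ p₀ j ^ 2) / (((F.L : ℝ) ^ Ts / γ) * θBal F.L γ b₀ p₀ Ts ^ 2)) * w * (w / (((F.L : ℝ) ^ Ts / γ) * θBal F.L γ b₀ p₀ Ts ^ 2)) + δV1 j * (((F.L : ℝ) ^ j / γ) * θBal F.L γ b₀ p₀ j ^ 2)) hθ4 Prof
        hJV0 𝒢 NG₀ hG0 hNG₀ hGrow₀ hCov K2 NY hK20 hK2mass hProf2 x₀ hx₀ hProf0 hM1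
    · exact jv2ClauseSq_of_covKernel_profiles τ (fun X z => Real.log (ρ Ts (Φ (X, z))) - Real.log (ρ' Ts (Φ (X, z))))
        (fun t Xw z => (wgt F γ b₀ p₀ j Ts ρ ρ' τ Φ J t) Xw z) (θBal F.L γ b₀ p₀ j / 4) rc κ (NV2 * ((((F.L : ℝ) ^ j / γ) * θBal F.L γ b₀ p₀ j ^ 2) / (((F.L : ℝ) ^ Ts / γ) * θBal F.L γ b₀ p₀ Ts ^ 2)) * w * (w / (((F.L : ℝ) ^ Ts / γ) * θBal F.L γ b₀ p₀ Ts ^ 2)) + δV2 j * (((F.L : ℝ) ^ j / γ) * θBal F.L γ b₀ p₀ j ^ 2)) hθ4 Prof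
        𝒢 ωf NG hG0 hωf hNG hGrow hCov K ωX Ncol Nrow hK0 hωX hNrow hKcol hKrow htri hProf1 hM2
    · -- (JV3-h′)sq ⟸ (I-law-V3)sq by ✓p819236 `jv3Sq_of_ilaw` + ✓p819333
      exact jv3Sq_of_ilawAE F γ b₀ p₀ j Ts ρ ρ' τ Φ J κ rc w NV3 δV3 hw0 hmF hΦm hJm hρm hρ'm hχc hPV3 hV3
    · -- (JV4-h′) ⟸ (I-law-V4) by ✓p817560 `jv4_of_ilaw` + ✓p819333
      exact jv4_of_ilawAE F γ b₀ p₀ j Ts ρ ρ' τ Φ J κ rc w NV4 δV4 hw0 hmF hΦm hJm hρm hρ'm hχc hSV4 hV4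

end Summit.QuantumFields.YangMills.Theorems.OrganTangentSpreadFibreLawHJsqOfDischargeInputsSqV04E

end
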